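import Summits.QuantumAdvantage.AdviceFreeQNC0.Elimination
import Mathlib.Analysis.SpecialFunctions.Complex.Circle
import HarnessLib

/-!
# Cell qa-qnc0 (`p = 3`): the SUPPORT-GAP exponential-sum lemma E3′ `SupportGapPhase3`

Planner qa-qnc0-p1 g15, ROUND-14 §4ter R3 (vi) / `Sketch18.lean` §5–§6 (statements `sgnOf`, `omegaThree`, `bandSum`,
`segFlip`, `SupportGapPhase3` VERBATIM; proof card `LINE-R1.md` §3).  This file: the statements and the
toolkit — the order-3 character `χ(a) = ω^a` (`chi_add`, `norm_one_add_chi`: `|1 + ω^T| = 2·[T = 0] + 1·[T ≠ 0]`),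
segment flips (`linPhase_segFlip`: `ℓ(segFlip s) = ℓ(s) + T_J(s)` as `−1 = 1 + 1` in `𝔽₃`), and the one-segment
factorisation `sum_mul_eq_of_blind`.  The theorem **`supportGapPhase3 : SupportGapPhase3`** (for ANY `h`
invariant under the flips of `m` pairwise disjoint spin segments of length `L` and any nowhere-zero linear
phase, `|Σ_s ω^{ℓ(s)+h(s)}| ≤ 2ⁿ·(2/3 + 3⁻¹2^{-L})^m`) is `SupportGapPhaseProof.lean`.

Proof (flip averaging, one segment at a time): pairing `s` with its flip on a segment `J` gives
`Σ_s ω^{ℓ+h}Φ = Σ_s ω^{ℓ}·Φ·(1 + ω^{T_J})/2` with `T_J(s) = Σ_{i∈J} ε_i s_i` (as `−2 ≡ 1 (mod 3)`), and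
`|1 + ω^T| = 2·[T = 0] + 1·[T ≠ 0]`; an induction on `m` carries a weight `Φ` (flip-invariant) dominated by a
function `B` blind to the remaining segments; the one-segment factorisation `Σ_s B·g = 2^{-n}(Σ B)(Σ g)` (for `B`
blind to `J`, `g` a function of `J` only) is proved by the mixing involution `(s,s') ↦ (s|_{Jᶜ} ∪ s'|_J, s'|_{Jᶜ} ∪ s|_J)`
of the double cube; and `3·#{s : T_J(s) = 0} ≤ 2ⁿ + 2·2^{n−L}` by the order-3 character sum
`Σ_s ω^{kT_J(s)} = (−1)^L 2^{n−L}` (`Fintype.prod_sum`).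

Message (planner qa-qnc0-p1): the walk phase cancels wherever the selector is not looking — a successful bell must
watch a boundary bond of every long segment; complementary to E3 (`BandPhase3`: bounded range, any support).
WHAT THIS IS NOT: nothing on E3 / `BandPhaseLin3`, nothing on the `p = 3` crux `RingHardOdd 3` or R3 `OneBellDWB3`;
separation NOT moved.
-/

noncomputable section

namespace Summit.QuantumAdvantage.AdviceFreeQNC0

open Classical
open Finset

/-! ### Statements (planner qa-qnc0-p1 Sketch18 §5–§6, verbatim) -/

/-- The sign read off a Boolean: `true ↦ −1`, `false ↦ 1` in `𝔽₃`. (Sketch18 §5, verbatim.) -/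
def sgnOf {n : ℕ} (s : Fin n → Bool) (i : Fin n) : ZMod 3 := if s i then -1 else 1

/-- `ω = e^{2πi/3}` (Sketch18 §5, verbatim; the same term as `Elimination.zeta3`). -/
def omegaThree : ℂ := Complex.exp (2 * Real.pi * Complex.I / 3)

/-- The exponential sum `Z(ε, h) = Σ_{s ∈ {±1}ⁿ} ω^{Σ_i ε_i s_i + h(s)}`. (Sketch18 §5, verbatim.) -/
def bandSum {n : ℕ} (ε : Fin n → ZMod 3) (h : (Fin n → Bool) → ZMod 3) : ℂ :=
  ∑ s : Fin n → Bool, omegaThree ^ ((∑ i, ε i * sgnOf s i) + h s).val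

/-- `segFlip a L s`: flip the spins `a, …, a+L-1` of `s`. (A function of the domain WALLS whose support avoids
the two boundary bonds `a` and `a+L` is invariant under it; interior walls are unchanged by a joint flip.)
(Sketch18 §6, verbatim.) -/
def segFlip {n : ℕ} (a L : ℕ) (s : Fin n → Bool) : Fin n → Bool :=
  fun i => if a ≤ i.val ∧ i.val < a + L then !s i else s i

/-- **(E3′) `SupportGapPhase3` — the support-gap exponential sum lemma** (Sketch18 §6, verbatim): for ANY `h`
(no degree or range hypothesis) invariant under the flips of `m` pairwise disjoint segments of length `L`, and
any nowhere-zero linear phase, `|Z(ε,h)| ≤ 2ⁿ·(2/3 + 3⁻¹2^{-L})^m`. PROVED: `supportGapPhase3`. -/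
def SupportGapPhase3 : Prop :=
  ∀ (n L m : ℕ) (ε : Fin n → ZMod 3), (∀ i, ε i ≠ 0) →
    ∀ a : Fin m → ℕ, (∀ j, a j + L ≤ n) → (∀ j j', j ≠ j' → a j + L ≤ a j' ∨ a j' + L ≤ a j) →
    ∀ h : (Fin n → Bool) → ZMod 3, (∀ j s, h (segFlip (a j) L s) = h s) →
      ‖bandSum ε h‖ ≤ (2 : ℝ) ^ n * (2 / 3 + 3⁻¹ * (2⁻¹ : ℝ) ^ L) ^ m

namespace SupportGap

/-! ### The order-3 character `χ(a) = ω^{a}` -/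

/-- `ω³ = 1`. -/
theorem omegaThree_pow_three : omegaThree ^ 3 = 1 := by
  have h := Complex.isPrimitiveRoot_exp 3 (by norm_num)
  have e : Complex.exp (2 * Real.pi * Complex.I / (3 : ℕ)) = omegaThree := by
    unfold omegaThree; push_cast; ring_nf
  rw [← e]
  exact h.pow_eq_one

/-- `‖ω‖ = 1`. -/
theorem norm_omegaThree : ‖omegaThree‖ = 1 := by
  have h := Complex.isPrimitiveRoot_exp 3 (by norm_num)
  have e : Complex.exp (2 * Real.pi * Complex.I / (3 : ℕ)) = omegaThree := by
    unfold omegaThree; push_cast; ring_nf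
  rw [← e]
  exact h.norm'_eq_one (by norm_num)

/-- `1 + ω + ω² = 0`. -/
theorem omegaThree_sum : 1 + omegaThree + omegaThree ^ 2 = 0 := by
  have h := Complex.isPrimitiveRoot_exp 3 (by norm_num)
  have e : Complex.exp (2 * Real.pi * Complex.I / (3 : ℕ)) = omegaThree := by
    unfold omegaThree; push_cast; ring_nf
  rw [← e] at *
  have hs := h.geom_sum_eq_zero (by norm_num : 1 < 3)
  simpa [Finset.sum_range_succ, add_assoc] using hs

/-- The character `χ(a) = ω^{a.val}`. -/
def chi (a : ZMod 3) : ℂ := omegaThree ^ a.val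

/-- `χ(0) = 1`. -/
@[simp] theorem chi_zero : chi 0 = 1 := by
  simp [chi]

/-- `χ` is multiplicative: `χ(a + b) = χ(a)·χ(b)`. -/
theorem chi_add (a b : ZMod 3) : chi (a + b) = chi a * chi b := by
  unfold chi
  rw [ZMod.val_add, ← pow_eq_pow_mod _ omegaThree_pow_three, pow_add]

/-- `‖χ(a)‖ = 1`. -/
theorem norm_chi (a : ZMod 3) : ‖chi a‖ = 1 := by
  unfold chi
  rw [norm_pow, norm_omegaThree, one_pow]

/-- `χ` of a sum is the product of the `χ`'s. -/
theorem chi_sum {ι : Type*} (S : Finset ι) (f : ι → ZMod 3) :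
    chi (∑ i ∈ S, f i) = ∏ i ∈ S, chi (f i) := by
  induction S using Finset.induction_on with
  | empty => simp
  | insert a S ha ih => rw [sum_insert ha, prod_insert ha, chi_add, ih]

/-- `χ(c) + χ(−c) = −1` for `c ≠ 0` (`ω + ω² = −1`). -/
theorem chi_add_chi_neg {c : ZMod 3} (hc : c ≠ 0) : chi c + chi (-c) = -1 := by
  have key : ∀ c : ZMod 3, c ≠ 0 → (c.val = 1 ∧ (-c).val = 2) ∨ (c.val = 2 ∧ (-c).val = 1) := by
    decide
  unfold chi
  rcases key c hc with ⟨h1, h2⟩ | ⟨h1, h2⟩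
  · rw [h1, h2, pow_one]; linear_combination omegaThree_sum
  · rw [h1, h2, pow_one]; linear_combination omegaThree_sum

/-- `‖1 + χ(a)‖ = 2` if `a = 0`, `= 1` otherwise. -/
theorem norm_one_add_chi (a : ZMod 3) : ‖1 + chi a‖ = if a = 0 then 2 else 1 := by
  have key : ∀ a : ZMod 3, a = 0 ∨ (a ≠ 0 ∧ a.val = 1) ∨ (a ≠ 0 ∧ a.val = 2) := by decide
  unfold chi
  rcases key a with h0 | ⟨hne, h1⟩ | ⟨hne, h2⟩
  · rw [if_pos h0, h0, ZMod.val_zero, pow_zero]; norm_num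
  · rw [if_neg hne, h1, pow_one]
    have : 1 + omegaThree = -(omegaThree ^ 2) := by linear_combination omegaThree_sum
    rw [this, norm_neg, norm_pow, norm_omegaThree, one_pow]
  · rw [if_neg hne, h2]
    have : 1 + omegaThree ^ 2 = -omegaThree := by linear_combination omegaThree_sum
    rw [this, norm_neg, norm_omegaThree]

/-! ### Segment flips -/

variable {n : ℕ}

/-- `sgnOf` of a flipped spin is negated inside the segment and unchanged outside. -/
theorem sgnOf_segFlip (a L : ℕ) (s : Fin n → Bool) (i : Fin n) :
    sgnOf (segFlip a L s) i = if a ≤ i.val ∧ i.val < a + L then -sgnOf s i else sgnOf s i := by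
  unfold sgnOf segFlip
  by_cases h : a ≤ i.val ∧ i.val < a + L
  · rw [if_pos h, if_pos h]
    cases s i <;> simp
  · rw [if_neg h, if_neg h]

/-- A segment flip is an involution. -/
theorem segFlip_segFlip (a L : ℕ) (s : Fin n → Bool) : segFlip a L (segFlip a L s) = s := by
  funext i
  unfold segFlip
  by_cases h : a ≤ i.val ∧ i.val < a + L
  · rw [if_pos h, if_pos h, Bool.not_not]
  · rw [if_neg h, if_neg h]

/-- The segment sum `T_J(s) = Σ_{i ∈ J} ε_i s_i`, `J = [a, a+L)`. -/
def segSum (ε : Fin n → ZMod 3) (a L : ℕ) (s : Fin n → Bool) : ZMod 3 :=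
  ∑ i, if a ≤ i.val ∧ i.val < a + L then ε i * sgnOf s i else 0

/-- **The phase shift of a flip**: `ℓ(segFlip s) = ℓ(s) + T_J(s)` (as `−1 = 1 + 1` in `𝔽₃`). -/
theorem linPhase_segFlip (ε : Fin n → ZMod 3) (a L : ℕ) (s : Fin n → Bool) :
    (∑ i, ε i * sgnOf (segFlip a L s) i) = (∑ i, ε i * sgnOf s i) + segSum ε a L s := by
  unfold segSum
  rw [← Finset.sum_add_distrib]
  refine Finset.sum_congr rfl fun i _ => ?_
  rw [sgnOf_segFlip]
  by_cases h : a ≤ i.val ∧ i.val < a + L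
  · rw [if_pos h, if_pos h]
    have h2 : (-1 : ZMod 3) = 1 + 1 := by decide
    linear_combination (ε i * sgnOf s i) * h2
  · rw [if_neg h, if_neg h, add_zero]

/-- A flip of a DISJOINT segment does not change `T_J`. -/
theorem segSum_segFlip_of_disjoint (ε : Fin n → ZMod 3) {a L a' : ℕ}
    (hdis : a + L ≤ a' ∨ a' + L ≤ a) (s : Fin n → Bool) :
    segSum ε a L (segFlip a' L s) = segSum ε a L s := by
  unfold segSum
  refine Finset.sum_congr rfl fun i _ => ?_
  by_cases h : a ≤ i.val ∧ i.val < a + L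
  · rw [if_pos h, if_pos h, sgnOf_segFlip, if_neg (by omega)]
  · rw [if_neg h, if_neg h]

/-- `T_J` depends only on the spins in `J`. -/
theorem segSum_congr (ε : Fin n → ZMod 3) (a L : ℕ) {s s' : Fin n → Bool}
    (h : ∀ i : Fin n, a ≤ i.val ∧ i.val < a + L → s i = s' i) :
    segSum ε a L s = segSum ε a L s' := by
  unfold segSum
  refine Finset.sum_congr rfl fun i _ => ?_
  by_cases hi : a ≤ i.val ∧ i.val < a + L
  · rw [if_pos hi, if_pos hi]; unfold sgnOf; rw [h i hi]
  · rw [if_neg hi, if_neg hi]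

/-! ### The one-segment factorisation (mixing involution on the double cube) -/

/-- Overwrite `s` on `J = [a, a+L)` by `s'`. -/
def mix (a L : ℕ) (s s' : Fin n → Bool) : Fin n → Bool :=
  fun i => if a ≤ i.val ∧ i.val < a + L then s' i else s i

/-- The mixing map of the double cube is an involution. -/
theorem mix_mix (a L : ℕ) (p : (Fin n → Bool) × (Fin n → Bool)) :
    (mix a L (mix a L p.1 p.2) (mix a L p.2 p.1), mix a L (mix a L p.2 p.1) (mix a L p.1 p.2)) = p := by
  obtain ⟨s, s'⟩ := p
  simp only [Prod.mk.injEq]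
  constructor
  · funext i; unfold mix; by_cases h : a ≤ i.val ∧ i.val < a + L <;> simp [h]
  · funext i; unfold mix; by_cases h : a ≤ i.val ∧ i.val < a + L <;> simp [h]

/-- **One-segment factorisation**: if `B` is blind to the spins in `J` and `g` sees only them, then
`2ⁿ·Σ_s B(s)g(s) = (Σ_s B(s))·(Σ_s g(s))`. -/
theorem sum_mul_eq_of_blind (a L : ℕ) (B g : (Fin n → Bool) → ℝ)
    (hB : ∀ s s' : Fin n → Bool, (∀ i : Fin n, ¬ (a ≤ i.val ∧ i.val < a + L) → s i = s' i) → B s = B s')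
    (hg : ∀ s s' : Fin n → Bool, (∀ i : Fin n, a ≤ i.val ∧ i.val < a + L → s i = s' i) → g s = g s') :
    (2 : ℝ) ^ n * ∑ s, B s * g s = (∑ s, B s) * ∑ s, g s := by
  rw [Finset.sum_mul_sum, ← Fintype.sum_prod_type']
  -- reindex the double sum by the mixing involution
  have hinv : Function.Involutive (fun p : (Fin n → Bool) × (Fin n → Bool) =>
      (mix a L p.1 p.2, mix a L p.2 p.1)) := fun p => mix_mix a L p
  rw [← Equiv.sum_comp hinv.toPerm (fun p : (Fin n → Bool) × (Fin n → Bool) => B p.1 * g p.2)]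
  have hpt : ∀ p : (Fin n → Bool) × (Fin n → Bool),
      B ((Function.Involutive.toPerm _ hinv) p).1 * g ((Function.Involutive.toPerm _ hinv) p).2 =
        B p.1 * g p.1 := by
    intro p
    rw [Function.Involutive.coe_toPerm]
    show B (mix a L p.1 p.2) * g (mix a L p.2 p.1) = B p.1 * g p.1
    rw [hB (mix a L p.1 p.2) p.1 (fun i hi => by unfold mix; rw [if_neg hi]),
      hg (mix a L p.2 p.1) p.1 (fun i hi => by unfold mix; rw [if_pos hi])]
  rw [Fintype.sum_congr _ _ hpt, Fintype.sum_prod_type]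
  simp only [Finset.sum_const, Finset.card_univ, Fintype.card_fun, Fintype.card_bool, Fintype.card_fin,
    nsmul_eq_mul]
  push_cast
  rw [Finset.mul_sum]

end SupportGap

end Summit.QuantumAdvantage.AdviceFreeQNC0

end
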